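import Literature.NumberTheory.GaloisRepresentations.SUnitsLayerInflation
import Literature.Algebra.Homology.DiscreteRepSubgroupLayers
import HarnessLib

/-!
# Two layers `E ≤ E′` of an open `U ≤ G_{K,S}`: the subgroup `Gal(K_S/E) ⧸ Gal(K_S/E′) ≤ U ⧸ Gal(K_S/E′)`
# IS `Gal(E′/E) ≤ Gal(E′/F₀)`, and the layers `Gal(K_S/E′)`, `E′ ≥ E`, are cofinal in `Gal(K_S/E)`
# (Neukirch–Schmidt–Wingberg VIII §3, (1.5.1); Serre, *Cohomologie galoisienne* I §2.2 Prop. 8)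

Topic `NumberTheory/GaloisRepresentations`; namespace
`Literature.NumberTheory.GaloisRepresentations.OpenSubgroupLayer`.  Sequel of
`RestrictedRamificationOpenSubgroupLayers` ((A2-β1): `baseField`, `algOfLE`, `layerHom`, `layerSubgroup`,
`layerEquiv`, `exists_layerSubgroup_le`).  Two definitions with bodies (a group homomorphism and the group
isomorphism it induces — plumbing) and theorems; NO named fact, no `sorry`, no instance, no notation.

SETTING.  `K` a number field, `S` a set of finite places, `H ≤ Γ_K` open, `U := galoisGroupAbove S H`,
`F₀ := baseField H`, and two layers `E ≤ E′` (`IdeleClassBar.GalLayer K`) with `F₀ ≤ E`, `N_S ≤ Gal(K̄/E)` and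
`N_S ≤ Gal(K̄/E′)`.  Write `W := layerSubgroup S hHo E hF hS = Gal(K_S/E)` and
`V := layerSubgroup S hHo E′ (hF.trans hEE′) hS′ = Gal(K_S/E′)`, so `V ≤ W` (`layerSubgroup_anti`), and
`W̄ := W.map (QuotientGroup.mk' V) ≤ U ⧸ V` — the subgroup through which the `Δ = U ⧸ W`-module `Maps(Δ, M)`
is read on the layer `V` (`ContinuousShapiroOpenCoinducedLayerModule.coindOpenHRep_layer_conj`:
`conjRepCohomology W̄ _`).  With the inclusion algebras `algOfLE` (`F₀ → E → E′`):

* §1 `coe_layerEquiv_apply_eq_self_of_mem` / `mem_layerSubgroup_of_forall`: `u ∈ W` iff `layerEquiv E′ [u]`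
  fixes `E` pointwise; `mk_mem_map_layerSubgroup_iff`: `[u] ∈ W̄ ↔ u ∈ W`;
* §2 **`relEquiv : ↥W̄ ≃* (E′ ≃ₐ[E] E′)`**, with **`restrictScalars_relEquiv : (relEquiv n).restrictScalars F₀ =
  layerEquiv E′ n`** — `W̄` IS the subgroup `Gal(E′/E)` of `Gal(E′/F₀) ≃ U ⧸ V`, in the hypothesis shape
  `(e, he)` of `IdeleLocalInvariantsConjugation.resIdeleRepIsoOfEquiv` — and `relEquiv_symm_apply_coe`;
* §3 **cofinality inside `W`** (`exists_layer_traceOpenNormalSubgroup_le`): every open normal subgroup of `↥W`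
  contains the trace `V ∩ W = V` of the layer subgroup of some layer `E′ ≥ E` (door-c6
  `exists_traceOpenNormalSubgroup_le` + `exists_layerSubgroup_le` + the compositum `E ⊔ E₁`) — the `cofinal`
  field of door-c4's `LayerColimit.IsCompatibleFamily` for the family of layers `E′ ≥ E` of `↥W`.

Lane «TATE-EPC-TC» of cell `bsd-eis` (crux `GoodLatticeBDPValue`, stmt-BirchSwinnertonDyer-19032), piece G1 (the
`W ⧸ V ↔ Gal(E′/E)` bridge between the layer dictionary of `Maps(Δ, E_S)` and the `S`-unit layers
`Hⁿ(Gal(E′/E), 𝒪_{E′,S}ˣ)`), file 1 of 2 (group side).  HONEST FRAMING: group-theoretic plumbing only; no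
statement of a Summit, of Tate's theorem or of the crux is proved here.

## References
* J. Neukirch, A. Schmidt, K. Wingberg, *Cohomology of Number Fields*, 2nd ed. (2008), VIII §3, (1.5.1).
  [NeukirchSchmidtWingberg2008]
* J.-P. Serre, *Cohomologie galoisienne* (1994), I §2.2 Prop. 8. [SerreGaloisCohomology1997]
* J. Neukirch, *Algebraic Number Theory* (1999), Ch. IV §1. [NeukirchANT1999]
-/

noncomputable section

open NumberField IsDedekindDomain Field Topology
open Literature.NumberTheory.GaloisRepresentations.IdeleClassBar (GalLayer)
open Literature.NumberTheory.GaloisRepresentations.LocalWeilDatum (galFixing mem_galFixing_iff galFixing_antitone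
  galFixing_sup)
open Literature.NumberTheory.IwasawaTheory.Greenberg2006 (galoisGroupAbove)
open Literature.Algebra.Homology.DiscreteRep (traceOpenNormalSubgroup traceOpenNormalSubgroup_mono
  exists_traceOpenNormalSubgroup_le)

namespace Literature.NumberTheory.GaloisRepresentations

namespace OpenSubgroupLayer

/-! ### §0. A subgroup lemma -/

/-- For `V ≤ W` with `V` normal: `[u] ∈ W.map (G → G ⧸ V) ↔ u ∈ W` (private helper). [folklore] -/
private theorem mk_mem_map_mk'_iff {G : Type*} [Group G] (W V : Subgroup G) [V.Normal] (hVW : V ≤ W) (u : G) :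
    (QuotientGroup.mk u : G ⧸ V) ∈ W.map (QuotientGroup.mk' V) ↔ u ∈ W := by
  constructor
  · intro h
    have h' : u ∈ (W.map (QuotientGroup.mk' V)).comap (QuotientGroup.mk' V) := h
    rwa [Subgroup.comap_map_eq_self (by rwa [QuotientGroup.ker_mk'])] at h'
  · exact fun h => ⟨u, h, rfl⟩

variable {K : Type} [Field K] [NumberField K] (S : Set (HeightOneSpectrum (𝓞 K)))
  {H : Subgroup (absoluteGaloisGroup K)} (hHo : IsOpen (H : Set (absoluteGaloisGroup K)))
  {E E' : GalLayer K} (hEE' : E ≤ E') (hF : baseField H ≤ E.1)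
  (hS : ramificationSubgroup K S ≤ galFixing K E.1) (hS' : ramificationSubgroup K S ≤ galFixing K E'.1)

/-! ### §1. `u ∈ Gal(K_S/E)` iff `layerEquiv E′ [u]` fixes `E` pointwise -/

/-- **For `u ∈ W = Gal(K_S/E)`, `layerEquiv E′ [u]` fixes `E ⊆ E′` pointwise** (on `K̄`-values it is `σ •` for a lift
`σ ∈ Gal(K̄/E)` of `u`). [cite: NeukirchSchmidtWingberg2008, VIII §3] -/
theorem coe_layerEquiv_apply_eq_self_of_mem {u : ↥(galoisGroupAbove S H)}
    (hu : u ∈ layerSubgroup S hHo E hF hS) (x : E.1) :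
    letI := algOfLE (hF.trans hEE')
    ((layerEquiv S hHo E' (hF.trans hEE') hS' (QuotientGroup.mk u) ⟨(x : AlgebraicClosure K), hEE' x.2⟩ : E'.1) :
        AlgebraicClosure K) = (x : AlgebraicClosure K) := by
  obtain ⟨σ, rfl⟩ := toAbove_surjective S H u
  rw [coe_layerEquiv_mk_toAbove]
  exact (mem_galFixing_iff K).1 ((toAbove_mem_layerSubgroup_iff S hHo E hF hS σ).1 hu) _ x.2

/-- **Conversely, if `layerEquiv E′ [u]` fixes `E` pointwise then `u ∈ W = Gal(K_S/E)`.**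
[cite: NeukirchSchmidtWingberg2008, VIII §3] [cite: NeukirchANT1999, Ch. IV §1] -/
theorem mem_layerSubgroup_of_forall {u : ↥(galoisGroupAbove S H)}
    (h : letI := algOfLE (hF.trans hEE')
      ∀ x : E.1, ((layerEquiv S hHo E' (hF.trans hEE') hS' (QuotientGroup.mk u)
        ⟨(x : AlgebraicClosure K), hEE' x.2⟩ : E'.1) : AlgebraicClosure K) = (x : AlgebraicClosure K)) :
    u ∈ layerSubgroup S hHo E hF hS := by
  obtain ⟨σ, rfl⟩ := toAbove_surjective S H u
  refine (toAbove_mem_layerSubgroup_iff S hHo E hF hS σ).2 ((mem_galFixing_iff K).2 fun x hx => ?_)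
  have h1 := h ⟨x, hx⟩
  rwa [coe_layerEquiv_mk_toAbove] at h1

/-- `V = Gal(K_S/E′) ≤ W = Gal(K_S/E)` (`layerSubgroup_anti` in the present hypotheses).
[cite: SerreGaloisCohomology1997, I §2.2 Prop. 8] -/
theorem layerSubgroup_le_of_le :
    ((layerSubgroup S hHo E' (hF.trans hEE') hS' : OpenNormalSubgroup ↥(galoisGroupAbove S H)) :
        Subgroup ↥(galoisGroupAbove S H)) ≤ layerSubgroup S hHo E hF hS :=
  layerSubgroup_anti S hHo hEE' hF hS'

/-- `[u] ∈ W̄ = W.map (U → U ⧸ V) ↔ u ∈ W`. [cite: NeukirchSchmidtWingberg2008, (1.5.1)] -/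
theorem mk_mem_map_layerSubgroup_iff (u : ↥(galoisGroupAbove S H)) :
    (QuotientGroup.mk u : ↥(galoisGroupAbove S H) ⧸
        ((layerSubgroup S hHo E' (hF.trans hEE') hS' : OpenNormalSubgroup ↥(galoisGroupAbove S H)) :
          Subgroup ↥(galoisGroupAbove S H))) ∈
      ((layerSubgroup S hHo E hF hS : OpenNormalSubgroup ↥(galoisGroupAbove S H)) :
          Subgroup ↥(galoisGroupAbove S H)).map
        (QuotientGroup.mk' ((layerSubgroup S hHo E' (hF.trans hEE') hS' : OpenNormalSubgroup ↥(galoisGroupAbove S H)) :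
          Subgroup ↥(galoisGroupAbove S H))) ↔
      u ∈ layerSubgroup S hHo E hF hS :=
  mk_mem_map_mk'_iff _ _ (layerSubgroup_le_of_le S hHo hEE' hF hS hS') u

/-- Every element of `W̄` fixes `E` pointwise through `layerEquiv E′`. [cite: NeukirchSchmidtWingberg2008, VIII §3] -/
theorem coe_layerEquiv_apply_eq_self_of_mem_map
    (n : ↥(((layerSubgroup S hHo E hF hS : OpenNormalSubgroup ↥(galoisGroupAbove S H)) :
          Subgroup ↥(galoisGroupAbove S H)).map
        (QuotientGroup.mk' ((layerSubgroup S hHo E' (hF.trans hEE') hS' : OpenNormalSubgroup ↥(galoisGroupAbove S H)) :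
          Subgroup ↥(galoisGroupAbove S H)))))
    (x : E.1) :
    letI := algOfLE (hF.trans hEE')
    ((layerEquiv S hHo E' (hF.trans hEE') hS' n.1 ⟨(x : AlgebraicClosure K), hEE' x.2⟩ : E'.1) : AlgebraicClosure K) =
      (x : AlgebraicClosure K) := by
  obtain ⟨u, hu, hn⟩ := n.2
  rw [← hn]
  exact coe_layerEquiv_apply_eq_self_of_mem S hHo hEE' hF hS hS' hu x

/-! ### §2. `W̄ ≃* Gal(E′/E)` -/

/-- The homomorphism `W̄ → Gal(E′/E)`: `n ↦ layerEquiv E′ n`, which is `E`-linear by §1.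
[cite: NeukirchSchmidtWingberg2008, VIII §3, (1.5.1)] -/
def relHom :
    letI := algOfLE (show E.1 ≤ E'.1 from hEE')
    ↥(((layerSubgroup S hHo E hF hS : OpenNormalSubgroup ↥(galoisGroupAbove S H)) :
          Subgroup ↥(galoisGroupAbove S H)).map
        (QuotientGroup.mk' ((layerSubgroup S hHo E' (hF.trans hEE') hS' : OpenNormalSubgroup ↥(galoisGroupAbove S H)) :
          Subgroup ↥(galoisGroupAbove S H)))) →* (E'.1 ≃ₐ[E.1] E'.1) :=
  letI := algOfLE (show E.1 ≤ E'.1 from hEE')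
  letI := algOfLE (hF.trans hEE')
  { toFun := fun n => AlgEquiv.ofRingEquiv (f := (layerEquiv S hHo E' (hF.trans hEE') hS' n.1).toRingEquiv)
      (fun x => Subtype.ext (coe_layerEquiv_apply_eq_self_of_mem_map S hHo hEE' hF hS hS' n x))
    map_one' := by
      apply AlgEquiv.ext
      intro y
      rw [AlgEquiv.ofRingEquiv_apply, AlgEquiv.one_apply, OneMemClass.coe_one, map_one]
      rfl
    map_mul' := fun n m => by
      apply AlgEquiv.ext
      intro y
      rw [AlgEquiv.ofRingEquiv_apply, AlgEquiv.mul_apply, AlgEquiv.ofRingEquiv_apply, AlgEquiv.ofRingEquiv_apply,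
        Subgroup.coe_mul, map_mul]
      rfl }

/-- Formula: `relHom n` and `layerEquiv E′ n` are the same map of `E′`. [cite: NeukirchSchmidtWingberg2008, VIII §3] -/
theorem relHom_apply
    (n : ↥(((layerSubgroup S hHo E hF hS : OpenNormalSubgroup ↥(galoisGroupAbove S H)) :
          Subgroup ↥(galoisGroupAbove S H)).map
        (QuotientGroup.mk' ((layerSubgroup S hHo E' (hF.trans hEE') hS' : OpenNormalSubgroup ↥(galoisGroupAbove S H)) :
          Subgroup ↥(galoisGroupAbove S H)))))
    (y : E'.1) :
    letI := algOfLE (show E.1 ≤ E'.1 from hEE')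
    letI := algOfLE (hF.trans hEE')
    relHom S hHo hEE' hF hS hS' n y = layerEquiv S hHo E' (hF.trans hEE') hS' n.1 y := rfl

/-- `relHom` is bijective: injective because `layerEquiv E′` is, surjective because an `E`-automorphism `τ` of `E′`
is `layerEquiv E′ [u]` for some `u`, and `u ∈ W` by §1. [cite: NeukirchSchmidtWingberg2008, (1.5.1)]
[cite: NeukirchANT1999, Ch. IV §1] -/
theorem relHom_bijective :
    letI := algOfLE (show E.1 ≤ E'.1 from hEE')
    Function.Bijective (relHom S hHo hEE' hF hS hS') := by
  letI := algOfLE hF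
  letI := algOfLE (show E.1 ≤ E'.1 from hEE')
  letI := algOfLE (hF.trans hEE')
  haveI := SUnits.Layers.isScalarTower_algOfLE₃ hF (show E.1 ≤ E'.1 from hEE')
  constructor
  · intro n m h
    apply Subtype.ext
    apply (layerEquiv S hHo E' (hF.trans hEE') hS').injective
    apply AlgEquiv.ext
    intro y
    have h1 := AlgEquiv.congr_fun h y
    rwa [relHom_apply, relHom_apply] at h1
  · intro τ
    obtain ⟨q, hq⟩ := (layerEquiv S hHo E' (hF.trans hEE') hS').surjective (τ.restrictScalars (baseField H))
    induction q using QuotientGroup.induction_on with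
    | H u =>
      have hu : u ∈ layerSubgroup S hHo E hF hS := by
        refine mem_layerSubgroup_of_forall S hHo hEE' hF hS hS' fun x => ?_
        rw [hq, AlgEquiv.restrictScalars_apply]
        exact congrArg (fun z : E'.1 => (z : AlgebraicClosure K)) (τ.commutes x)
      refine ⟨⟨QuotientGroup.mk u, (mk_mem_map_layerSubgroup_iff S hHo hEE' hF hS hS' u).2 hu⟩, ?_⟩
      apply AlgEquiv.ext
      intro y
      rw [relHom_apply]
      exact (AlgEquiv.congr_fun hq y).trans (AlgEquiv.restrictScalars_apply _ _ y)

/-- **`W̄ = Gal(K_S/E) ⧸ Gal(K_S/E′) ≃* Gal(E′/E)`** (for the inclusion algebra `E → E′`).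
[cite: NeukirchSchmidtWingberg2008, VIII §3, (1.5.1)] [cite: SerreGaloisCohomology1997, I §2.2 Prop. 8] -/
def relEquiv :
    letI := algOfLE (show E.1 ≤ E'.1 from hEE')
    ↥(((layerSubgroup S hHo E hF hS : OpenNormalSubgroup ↥(galoisGroupAbove S H)) :
          Subgroup ↥(galoisGroupAbove S H)).map
        (QuotientGroup.mk' ((layerSubgroup S hHo E' (hF.trans hEE') hS' : OpenNormalSubgroup ↥(galoisGroupAbove S H)) :
          Subgroup ↥(galoisGroupAbove S H)))) ≃* (E'.1 ≃ₐ[E.1] E'.1) :=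
  letI := algOfLE (show E.1 ≤ E'.1 from hEE')
  MulEquiv.ofBijective (relHom S hHo hEE' hF hS hS') (relHom_bijective S hHo hEE' hF hS hS')

/-- Formula: `relEquiv n y = layerEquiv E′ n y`. [cite: NeukirchSchmidtWingberg2008, VIII §3] -/
theorem relEquiv_apply
    (n : ↥(((layerSubgroup S hHo E hF hS : OpenNormalSubgroup ↥(galoisGroupAbove S H)) :
          Subgroup ↥(galoisGroupAbove S H)).map
        (QuotientGroup.mk' ((layerSubgroup S hHo E' (hF.trans hEE') hS' : OpenNormalSubgroup ↥(galoisGroupAbove S H)) :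
          Subgroup ↥(galoisGroupAbove S H)))))
    (y : E'.1) :
    letI := algOfLE (show E.1 ≤ E'.1 from hEE')
    letI := algOfLE (hF.trans hEE')
    relEquiv S hHo hEE' hF hS hS' n y = layerEquiv S hHo E' (hF.trans hEE') hS' n.1 y := rfl

/-- **`(relEquiv n)|_{F₀} = layerEquiv E′ n`**: `W̄` is the subgroup `Gal(E′/E)` of `Gal(E′/F₀)` under
`layerEquiv E′ : U ⧸ V ≃* Gal(E′/F₀)`. [cite: NeukirchSchmidtWingberg2008, VIII §3, (1.5.1)] -/
theorem restrictScalars_relEquiv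
    (n : ↥(((layerSubgroup S hHo E hF hS : OpenNormalSubgroup ↥(galoisGroupAbove S H)) :
          Subgroup ↥(galoisGroupAbove S H)).map
        (QuotientGroup.mk' ((layerSubgroup S hHo E' (hF.trans hEE') hS' : OpenNormalSubgroup ↥(galoisGroupAbove S H)) :
          Subgroup ↥(galoisGroupAbove S H))))) :
    letI := algOfLE hF
    letI := algOfLE (show E.1 ≤ E'.1 from hEE')
    letI := algOfLE (hF.trans hEE')
    haveI := SUnits.Layers.isScalarTower_algOfLE₃ hF (show E.1 ≤ E'.1 from hEE')
    (relEquiv S hHo hEE' hF hS hS' n).restrictScalars (baseField H) = layerEquiv S hHo E' (hF.trans hEE') hS' n.1 := by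
  letI := algOfLE hF
  letI := algOfLE (show E.1 ≤ E'.1 from hEE')
  letI := algOfLE (hF.trans hEE')
  haveI := SUnits.Layers.isScalarTower_algOfLE₃ hF (show E.1 ≤ E'.1 from hEE')
  exact AlgEquiv.ext fun _ => rfl

/-- The value formula on `K̄`: `relEquiv [σ N_S] x = σ • x` for `σ ∈ H` with `σ N_S ∈ W`.
[cite: NeukirchSchmidtWingberg2008, VIII §3] -/
theorem coe_relEquiv_apply
    (n : ↥(((layerSubgroup S hHo E hF hS : OpenNormalSubgroup ↥(galoisGroupAbove S H)) :
          Subgroup ↥(galoisGroupAbove S H)).map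
        (QuotientGroup.mk' ((layerSubgroup S hHo E' (hF.trans hEE') hS' : OpenNormalSubgroup ↥(galoisGroupAbove S H)) :
          Subgroup ↥(galoisGroupAbove S H)))))
    {σ : H} (hσ : QuotientGroup.mk (toAbove S H σ) = n.1) (y : E'.1) :
    letI := algOfLE (show E.1 ≤ E'.1 from hEE')
    ((relEquiv S hHo hEE' hF hS hS' n y : E'.1) : AlgebraicClosure K) =
      (σ : absoluteGaloisGroup K) • (y : AlgebraicClosure K) := by
  letI := algOfLE (show E.1 ≤ E'.1 from hEE')
  letI := algOfLE (hF.trans hEE')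
  rw [relEquiv_apply, ← hσ]
  exact coe_layerEquiv_mk_toAbove S hHo E' (hF.trans hEE') hS' σ y

/-- The inverse direction: `layerEquiv E′ (relEquiv⁻¹ τ) = τ|_{F₀}`. [cite: NeukirchSchmidtWingberg2008, (1.5.1)] -/
theorem layerEquiv_relEquiv_symm (τ : letI := algOfLE (show E.1 ≤ E'.1 from hEE'); E'.1 ≃ₐ[E.1] E'.1) :
    letI := algOfLE hF
    letI := algOfLE (show E.1 ≤ E'.1 from hEE')
    letI := algOfLE (hF.trans hEE')
    haveI := SUnits.Layers.isScalarTower_algOfLE₃ hF (show E.1 ≤ E'.1 from hEE')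
    layerEquiv S hHo E' (hF.trans hEE') hS' ((relEquiv S hHo hEE' hF hS hS').symm τ).1 =
      τ.restrictScalars (baseField H) := by
  letI := algOfLE hF
  letI := algOfLE (show E.1 ≤ E'.1 from hEE')
  letI := algOfLE (hF.trans hEE')
  haveI := SUnits.Layers.isScalarTower_algOfLE₃ hF (show E.1 ≤ E'.1 from hEE')
  rw [← restrictScalars_relEquiv S hHo hEE' hF hS hS', MulEquiv.apply_symm_apply]

/-! ### §3. Cofinality inside `W`: the layers `Gal(K_S/E′)`, `E′ ≥ E` -/

/-- The trace `V ∩ W` of `V = Gal(K_S/E′)` on `W = Gal(K_S/E)` is `V` viewed in `W` (`subgroupOf`; door-c6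
`coe_traceOpenNormalSubgroup`). [cite: SerreGaloisCohomology1997, I §2.2 Prop. 8] -/
theorem coe_traceOpenNormalSubgroup_layerSubgroup :
    (traceOpenNormalSubgroup
        ((layerSubgroup S hHo E hF hS : OpenNormalSubgroup ↥(galoisGroupAbove S H)) : Subgroup ↥(galoisGroupAbove S H))
        (layerSubgroup S hHo E' (hF.trans hEE') hS') :
        Subgroup ↥((layerSubgroup S hHo E hF hS : OpenNormalSubgroup ↥(galoisGroupAbove S H)) :
          Subgroup ↥(galoisGroupAbove S H))) =
      ((layerSubgroup S hHo E' (hF.trans hEE') hS' : OpenNormalSubgroup ↥(galoisGroupAbove S H)) :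
          Subgroup ↥(galoisGroupAbove S H)).subgroupOf
        ((layerSubgroup S hHo E hF hS : OpenNormalSubgroup ↥(galoisGroupAbove S H)) : Subgroup ↥(galoisGroupAbove S H)) :=
  rfl

include hS in
omit [NumberField K] in
/-- `N_S ≤ Gal(K̄/(E ⊔ E₁))` when `N_S` fixes both `E` and `E₁`. [cite: NeukirchANT1999, Ch. IV §1] -/
theorem ramificationSubgroup_le_galFixing_sup {E₁ : GalLayer K} (hS₁ : ramificationSubgroup K S ≤ galFixing K E₁.1) :
    ramificationSubgroup K S ≤ galFixing K (GalLayer.sup E E₁).1 := by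
  change ramificationSubgroup K S ≤ galFixing K (E.1 ⊔ E₁.1)
  rw [galFixing_sup]
  exact le_inf hS hS₁

/-- **COFINALITY INSIDE `W`**: every open normal subgroup `V₁` of `↥W = Gal(K_S/E)` contains the trace
`Gal(K_S/E′) ∩ W` of the layer subgroup of some layer `E′ ≥ E` (door-c6 `exists_traceOpenNormalSubgroup_le` gives an
open normal `V₀ ≤ W` of `U` with `V₀ ∩ W ≤ V₁`; `exists_layerSubgroup_le` a layer `E₁` with `Gal(K_S/E₁) ≤ V₀`;
take `E′ := E ⊔ E₁`).  This is the `cofinal` field of door-c4's `LayerColimit.IsCompatibleFamily` for the family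
`E′ ↦ Gal(K_S/E′) ∩ W` of layers of `↥W` indexed by the layers `E′ ≥ E` inside `K_S`.
[cite: SerreGaloisCohomology1997, I §2.2 Prop. 8] [cite: NeukirchSchmidtWingberg2008, VIII §3, (1.5.1)] -/
theorem exists_layer_traceOpenNormalSubgroup_le [CompactSpace ↥(galoisGroupAbove S H)]
    [TotallyDisconnectedSpace ↥(galoisGroupAbove S H)] (hNH : ramificationSubgroup K S ≤ H)
    (V₁ : OpenNormalSubgroup ↥((layerSubgroup S hHo E hF hS : OpenNormalSubgroup ↥(galoisGroupAbove S H)) :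
      Subgroup ↥(galoisGroupAbove S H))) :
    ∃ (E' : GalLayer K) (hEE' : E ≤ E') (hS' : ramificationSubgroup K S ≤ galFixing K E'.1),
      (traceOpenNormalSubgroup
          ((layerSubgroup S hHo E hF hS : OpenNormalSubgroup ↥(galoisGroupAbove S H)) : Subgroup ↥(galoisGroupAbove S H))
          (layerSubgroup S hHo E' (hF.trans hEE') hS') :
          Subgroup ↥((layerSubgroup S hHo E hF hS : OpenNormalSubgroup ↥(galoisGroupAbove S H)) :
            Subgroup ↥(galoisGroupAbove S H))) ≤ V₁ := by
  obtain ⟨V₀, -, hV₀⟩ := exists_traceOpenNormalSubgroup_le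
    ((layerSubgroup S hHo E hF hS : OpenNormalSubgroup ↥(galoisGroupAbove S H)) : Subgroup ↥(galoisGroupAbove S H))
    (layerSubgroup S hHo E hF hS).isOpen' V₁
  obtain ⟨E₁, hF₁, hS₁, hE₁⟩ := exists_layerSubgroup_le S hHo hNH V₀
  refine ⟨GalLayer.sup E E₁, le_sup_left (a := E.1) (b := E₁.1), ramificationSubgroup_le_galFixing_sup S hS hS₁,
    le_trans (traceOpenNormalSubgroup_mono _ ?_) hV₀⟩
  exact (layerSubgroup_anti S hHo (le_sup_right (a := E.1) (b := E₁.1)) hF₁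
    (ramificationSubgroup_le_galFixing_sup S hS hS₁)).trans hE₁

end OpenSubgroupLayer

end Literature.NumberTheory.GaloisRepresentations

end
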